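import Literature.Barriers.CriticalPhenomena.AxisProfileAxiomaticsNoDoubling
import Summits.CriticalPhenomena.Ising3DConformalLimit.Theorems.HyperoctahedralRPExistsScaleCovariantLimitFoldedCurrentHeavyScaleDoubling
import Summits.CriticalPhenomena.Ising3DConformalLimit.Theorems.HyperoctahedralRPExistsScaleCovariantLimitFoldedCurrentSqrtDoublingDenominator
import Summits.CriticalPhenomena.Ising3DConformalLimit.Theorems.HyperoctahedralRPExistsScaleCovariantLimitFoldedCurrentAxisDcpProfile
import Summits.CriticalPhenomena.Ising3DConformalLimit.Theorems.HyperoctahedralRPExistsScaleCovariantLimitFoldedCurrentAxisSlidingProfile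
import Summits.CriticalPhenomena.Ising3DConformalLimit.Theses.MirrorHoelderCompactness
import Literature.Probability.LatticeModels.CriticalAxisRatioRegularity
import Literature.Probability.LatticeModels.PointwiseScalingLimitEtaExists
import HarnessLib

/-!
# The critical axis profile of `ℤ³` satisfies the axis-profile facts — so item 6150 is outside the
# reach of the barrier class `AxisProfileDoublingFor` (crux `ExistsScaleCovariantLimit`, line
# `folded-current-repulsion`, lead c16)

Companion of the barrier `Literature.Barriers.CriticalPhenomena.not_forall_axisProfileDoublingFor`
(`Literature/Barriers/CriticalPhenomena/AxisProfileAxiomaticsNoDoubling.lean`): the TRUE axis profile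
`n ↦ ⟨σ₀σ_{n e₀}⟩⁺_{β_c(3)} = criticalTwoPoint 3 (Pi.single 0 n)` satisfies every field of
`AxisProfileFacts` (tree theorems: `criticalTwoPoint_zero'`, `criticalTwoPoint_axis_pos`,
`criticalTwoPoint_axis_antitone` (MMS), `criticalTwoPoint_axis_ratio_mono` (RP), `axis_level_le` (IRB),
`axis_sq_level_ge` (Simon–Lieb), and the two registered sub-goals `axis_sliding_profile` (ADC21 Thm 5.6 in
profile form) and `axis_dcp_profile` (DCP25 Thm 1.3 in profile form)), and item
`TwoPointDoubling` (stmt-CriticalPhenomena-6150) is LITERALLY `AxisDoubling` of that profile. Together with the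
barrier's witness this is the kernel-checked form of the census diagnosis of crux 1981 (leads c9–c15,
strategists p1/s1): no proof of 6150 — hence of `WallRepulsion` (F2 of this line), `OrbitPrecompact`,
`UniformRegularity`, `PointwiseLimit`, `ZoomMonotone`, or the crux — factors through these facts.
-/

noncomputable section

open Literature.Probability.LatticeModels Literature.Barriers.CriticalPhenomena

namespace Summit.CriticalPhenomena.Ising3DConformalLimit.Cruxes.ExistsScaleCovariantLimit.FoldedCurrentRepulsion

/-- **The critical axis profile of the n.n. Ising model on `ℤ³` satisfies the axis-profile facts**
(normalisation, positivity, MMS antitonicity, RP ratio monotonicity, the two envelopes, the sliding-scale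
infrared bound and the Duminil-Copin–Panis bound in profile form).
[cite: AizenmanDuminilCopinAnnals2021, arXiv:1912.07973 §5 (Prop. 5.9, Thm 5.6)] -/
theorem axisProfileFacts_criticalAxis : Literature.Barriers.CriticalPhenomena.AxisProfileFacts (fun n : ℕ => Literature.Probability.LatticeModels.criticalTwoPoint 3 (Pi.single 0 (n : ℤ))) := by
  refine
    { zero := by simp [criticalTwoPoint_zero']
      pos := fun n => criticalTwoPoint_axis_pos n
      antitone := criticalTwoPoint_axis_antitone
      ratio_mono := ?_
      upper := ?_
      lower := axis_sq_level_ge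
      sliding := axis_sliding_profile
      dcp := axis_dcp_profile }
  · have h := criticalTwoPoint_axis_ratio_mono 0
    intro a b hab
    have := h hab
    simpa using this
  · obtain ⟨C, _, hC⟩ := axis_level_le
    exact ⟨C, hC⟩

/-- **Item 6150 is literally all-scale doubling of the critical axis profile.** -/
theorem twoPointDoubling_iff_axisDoubling : Summit.CriticalPhenomena.Ising3DConformalLimit.Theses.MirrorHoelderCompactness.TwoPointDoubling ↔ Literature.Barriers.CriticalPhenomena.AxisDoubling (fun n : ℕ => Literature.Probability.LatticeModels.criticalTwoPoint 3 (Pi.single 0 (n : ℤ))) := by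
  unfold Summit.CriticalPhenomena.Ising3DConformalLimit.Theses.MirrorHoelderCompactness.TwoPointDoubling
    Literature.Barriers.CriticalPhenomena.AxisDoubling
  constructor
  · rintro ⟨κ, hκ, h⟩
    refine ⟨κ, hκ, fun n hn => ?_⟩
    have := h n hn
    push_cast
    exact this
  · rintro ⟨κ, hκ, h⟩
    refine ⟨κ, hκ, fun n hn => ?_⟩
    have := h n hn
    push_cast at this
    exact this

/-- **The barrier bites on item 6150**: the technique class `AxisProfileDoublingFor` holds at the Ising
profile only if 6150 does (its hypotheses are discharged here, modulo the Källén–Lehmann named fact for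
the spectral clause), while the class fails at the barrier's witness — so 6150 is not a consequence of
the axis-profile facts. Formally: `AxisProfileDoublingFor g → HasAxisSpectralRepresentation g → TwoPointDoubling` at the Ising profile `g`. -/
theorem twoPointDoubling_of_axisProfileDoublingFor
    (h : AxisProfileDoublingFor (fun n : ℕ => criticalTwoPoint 3 (Pi.single 0 (n : ℤ))))
    (hsp : HasAxisSpectralRepresentation (fun n : ℕ => criticalTwoPoint 3 (Pi.single 0 (n : ℤ)))) :
    Summit.CriticalPhenomena.Ising3DConformalLimit.Theses.MirrorHoelderCompactness.TwoPointDoubling :=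
  twoPointDoubling_iff_axisDoubling.2 (h axisProfileFacts_criticalAxis hsp)

end Summit.CriticalPhenomena.Ising3DConformalLimit.Cruxes.ExistsScaleCovariantLimit.FoldedCurrentRepulsion

end
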